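import Literature.NumberTheory.GaloisCohomology.Howard2004.DVRSettingEngineRedProofs
import Literature.NumberTheory.GaloisCohomology.Howard2004.TowerMorphismPushforward
import Literature.NumberTheory.GaloisCohomology.PoitouTateSelmerStructures
import Literature.NumberTheory.GaloisRepresentations.DiscreteCochainsLongExact
import HarnessLib

/-!
# Howard 2004, Prop. 1.4.1 — the GLOBAL-DUALITY HALF of the left kernel, pairing-free: a class of
# `H¹_{𝓕(n)}(K, T^{(t)})` with a global lift to `H¹(K, T^{(t+1)})` lifts to `H¹_{𝓕(n)}(K, T^{(t+1)})` iff its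
# local defects are annihilated by `H¹_{𝓕(n)^*}(K, T̄^*)` under the sum of the local Tate pairings (proofs file)

Topic `NumberTheory/GaloisCohomology/Howard2004`. THEOREMS ONLY: no definition, no named fact, no instance, no notation,
no `sorry`.  Cell `pub/bsd-print-x9` (seat x10b-p1-w8 g12, brick «C451-LIFT-PT», `--supports stmt-BirchSwinnertonDyer-22642`;
print leaf G87 = Howard Thm. 1.6.1 ↦ (plan g15 r8) the «Flach leaf» C45.1′
`Literature.NumberTheory.GaloisCohomology.Howard2004.prop141_casselsTate_skewPairing_atLevel`; its kernel port targets the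
tower entry of x10b-p1-w7 g12, `CasselsTateSkewPairingOfTowerPairingProofs`, whose LEFT-kernel clause is «the left kernel of
`P₂ : 𝓗_t(n) × 𝓗_0(n) → R/𝔪` is `H¹(red)(𝓗_{t+1}(n))`», the right kernel being then automatic by
`CasselsTateTowerPairingOneKernelProofs`).

SOURCE. B. Howard, *The Heegner point Kolyvagin system*, Compositio Math. **140** (2004) = arXiv:1202.6340, Prop. 1.4.1
(p0008 L83–98: «… whose kernels on the left and right are the images of `H¹_𝓕(K, T/𝔪^{s+t}T) → H¹_𝓕(K, T/𝔪^sT)` […]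
The computation of the kernels is a straightforward modification of the methods of [Flach]»), Thm. 1.1.11 = arXiv Thm.
2.1.11 (p. 6: Poitou–Tate global duality for Selmer structures `𝓕 ≤ 𝓖`, «the images of the rightmost arrows are exact
orthogonal complements»), H.3 (p. 7: cartesian local conditions).  M. Flach, *A generalisation of the Cassels–Tate
pairing*, J. reine angew. Math. **412** (1990) 113–127, proof of Thm. 1 (the kernel computation: a class pairing to zero
has vanishing `Ш²`-obstruction, then its local defects are killed by a global class by Poitou–Tate).  A. Morgan, A. Smith,
*The Cassels–Tate pairing for finite Galois modules*, arXiv:2103.08530, Prop. 3.5 (left kernel `= π(Sel M)`).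

THE STATEMENT (what a kernel port consumes in the last step of the left-kernel computation).  Fix a `DVRSetting` `S` with
H.0–H.5, a level `t`, a finite set of primes `n`, and the short exact sequence of levels
`0 → T̄ = N_0 →ι N_{t+1} →red N_t → 0` presented by ANY `Γ_K`-equivariant injective `ι : N_0 → N_{t+1}` with
`range ι = ker red_{t+1→t}` (on a full tower `ι = inc^{t+1}`; the tree's `H¹(inc_{0→t+1})` is `Nat.leRec`-defined, so the
module map is taken as a datum) whose local `H¹`-maps make the conditions `𝓕(n)` CARTESIAN
(`ι_v⁻¹(𝓕(n)_{t+1,v}) = 𝓕(n)_{0,v}`, H.3 / Lemma 1.5.1 — hypothesis `hιF`).  Let `a ∈ H¹(K, N_t)` have a global lift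
`ã ∈ H¹(K, N_{t+1})`, `H¹(red) ã = a`, and let `m = (m_v)_v`, `m_v ∈ H¹(K_v, N_0)`, be LOCAL DEFECTS of `ã`:
`loc_v ã - ι_v m_v ∈ 𝓕(n)_{t+1,v}` at every place (they exist by the local exact sequences (1)(2) of p0008 L22–30 as soon as
`a` is an `𝓕(n)`-Selmer class), supported on a finite set of places `Σ` outside which `𝓕(n)_0` is unramified and `N_0` is
unramified and prime to the level `n₀` of the local invariants.  THEN, for any family `inv` of local invariant maps with
Poitou–Tate duality for Selmer structures (`SelmerComplement`, Howard Thm. 1.1.11 «annihilator ⊆ image») and the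
reciprocity law (`SumLocalTermEqZero`):
  `a ∈ H¹(red)(H¹_{𝓕(n)}(K, N_{t+1}))  ⟺  ∑_{v ∈ Σ} inv_v(m_v ∪ loc_v y) = 0 for every y ∈ H¹_{𝓕(n)_0^*}(K, N_0^*)`.

* §1 **`exists_cohomologyMap_eq_of_redLEH1_eq_zero`** — exactness of `H¹(K, N_0) →ι H¹(K, N_{t+1}) →red H¹(K, N_t)` in the
  middle for such a presentation (tree `IsSES` long exact sequence);
* §2 **`exists_selmer_redLEH1_eq_iff_exists_forall_sub_localization_mem`** — the SNAKE bookkeeping (no duality):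
  `a` lifts to `H¹_{𝓕(n)}(K, N_{t+1})` iff some GLOBAL `x ∈ H¹(K, N_0)` has `m_v - loc_v x ∈ 𝓕(n)_{0,v}` at every place;
* §3 **`exists_selmer_redLEH1_eq_iff_forall_sum_localTatePairingZMod_eq_zero`** — THE CRITERION above
  (§2 + `SelmerComplement` for `𝓕(n)_0 ≤ 𝓖 :=` «everything at `Σ`, `𝓕(n)_0` off `Σ`» + the vanishing of the local
  terms of global classes and of pairs in `𝓕 × 𝓕^*`);
* §4 **`exists_localDefects_of_forall_exists_redLELoc_eq`** — the data `m` of §2–§3 from local `𝓕(n)`-Selmer lifts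
  `ℓ_v` of `loc_v a` on `Σ` (Howard's surjections (2), p0008 L22–30 — supplied under `¬ p ∣ #𝓞_Kˣ` by the cell's
  LEVEL-EXACT brick) and `loc_v ã ∈ 𝓕(n)_{t+1,v}` off `Σ` (place-by-place middle exactness).

READING (numbers, for the desk).  With this file, what remains of the LEFT-kernel computation (MS Prop. 3.5 / Flach) for
a kernel port is: (a) the construction of the pairing with VALUE `∑_v inv_v(m_v ∪ y_v)` on classes whose `Ш²(K, N_0)`-
obstruction vanishes (cochains, MS Def. 3.2), and (b) the `Ш²`-step «pairs to zero ⟹ `δa = 0`» (the pairing restricted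
to `Ш¹(K, N_0^*)` is the Poitou–Tate pairing with `δa ∈ Ш²(K, N_0)`, perfect by the KERNEL theorem
`poitouTate_sha_tateDual`); the Poitou–Tate-for-Selmer-structures step (c) is THIS file, and the identification of
`H¹_{𝓕(n)_0^*}(K, N_0^*)` with `𝓗_0(n)` is H.4 (`ResidualTateDualBijectiveProofs` / `ResidualSelfOrthogonalProofs`).

HONEST FRAMING: no pairing is constructed; Prop. 1.4.1, Thm. 1.4.2, C45.1′ and `thm161_dvrKolyvaginBound` are NOT proved;
no summit statement is proved; the Birch–Swinnerton-Dyer conjecture is not proved by any of this.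
-/

set_option autoImplicit false

noncomputable section

namespace Literature.NumberTheory.GaloisCohomology.Howard2004

open Function NumberField IsDedekindDomain Field CategoryTheory
open scoped NumberField ContRepresentation
open Literature.NumberTheory.GaloisRepresentations
open Literature.NumberTheory.GaloisRepresentations.DiscreteGaloisModule
open Literature.NumberTheory.GaloisCohomology (LocalInvariants)

namespace DVRSetting

variable {p : ℕ} [Fact p.Prime] {K : Type} [Field K] [NumberField K]
  {R : Type} [CommRing R] [IsDomain R] [IsDiscreteValuationRing R] [Algebra ℤ_[p] R]
  {N : ℕ → Type} [∀ k, AddCommGroup (N k)] [∀ k, TopologicalSpace (N k)]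
  [∀ k, DiscreteTopology (N k)] [∀ k, Module R (N k)]
  {Rk : ℕ → Type} [∀ k, CommRing (Rk k)] [∀ k, IsLocalRing (Rk k)] [∀ k, TopologicalSpace (Rk k)]
  [∀ k, DiscreteTopology (Rk k)] [∀ k, Algebra ℤ_[p] (Rk k)] [∀ k, Algebra R (Rk k)]
  [∀ k, Module (Rk k) (N k)] [∀ k, IsScalarTower R (Rk k) (N k)]
  {Nbar : Type} [AddCommGroup Nbar] [TopologicalSpace Nbar] [DiscreteTopology Nbar]
  [∀ k, Module (Rk k) Nbar]
  {Nq : ℕ → Finset (HeightOneSpectrum (𝓞 K)) → Type} [∀ k n, AddCommGroup (Nq k n)]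
  [∀ k n, TopologicalSpace (Nq k n)] [∀ k n, DiscreteTopology (Nq k n)]
  [∀ k n, Module (Rk k) (Nq k n)] [∀ k n, Module R (Nq k n)]
  [∀ k n, IsScalarTower R (Rk k) (Nq k n)]

/-! ## §1 Exactness of `H¹(K, N_0) →ι H¹(K, N_{t+1}) →red H¹(K, N_t)` in the middle -/

/-- **Middle exactness of the global `H¹` sequence of `0 → N_0 →ι N_{t+1} →red N_t → 0`**: for a `Γ_K`-equivariant
injective `ι` with `range ι = ker red_{t+1→t}` (a presentation of the kernel of the reduction — on a full tower
`ι = inc^{t+1}`, `ker red = 𝔪^{e_t} T^{(t+1)}`), a class `c ∈ H¹(K, N_{t+1})` with `H¹(red) c = 0` is `H¹(ι) b` for some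
`b ∈ H¹(K, N_0)` (long exact sequence of the short exact sequence of discrete modules).
[cite: Howard2004HeegnerKolyvagin, §1.3 H.0 and Lemma 1.3.3 (arXiv:1202.6340 p. 7 L152–160), §1.6 (p0011 L33–38)]
[cite: SerreGaloisCohomology1997, Ch. I §2.2] -/
theorem exists_cohomologyMap_eq_of_redLEH1_eq_zero (S : DVRSetting p K R N Rk Nbar Nq) {i t : ℕ}
    (hit : i ≤ t + 1) (ι : N 0 →ₗ[R] N (t + 1))
    (hιg : ∀ (g : absoluteGaloisGroup K) (x : N 0), ι (S.T.ρ 0 g x) = S.T.ρ (t + 1) g (ι x))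
    (hιinj : Function.Injective ι) (hιex : ∀ y : N (t + 1), S.T.redLE hit y = 0 ↔ ∃ x, ι x = y)
    (c : galoisCohomology (S.T.ρ (t + 1)) 1) (hc : S.redLEH1 hit c = 0) :
    ∃ b : galoisCohomology (S.T.ρ 0) 1,
      ContinuousRep.cohomologyMap (S.T.ρ 0) (S.T.ρ (t + 1)) ι.toAddMonoidHom continuous_of_discreteTopology hιg 1 b
        = c := by
  let f : (S.T.ρ 0).toTopRep ⟶ (S.T.ρ (t + 1)).toTopRep :=
    TopRep.ofHom ⟨⟨ι.toAddMonoidHom.toIntLinearMap, continuous_of_discreteTopology⟩,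
      fun g => ContinuousLinearMap.ext fun x => hιg g x⟩
  let g : (S.T.ρ (t + 1)).toTopRep ⟶ (S.T.ρ i).toTopRep :=
    TopRep.ofHom ⟨⟨(S.T.redLE hit).toAddMonoidHom.toIntLinearMap, continuous_of_discreteTopology⟩,
      fun g => ContinuousLinearMap.ext fun x => S.T.redLE_equivariant hit g x⟩
  have hSES : IsSES f g :=
    { comp_eq_zero := by
        ext x
        exact (hιex (ι x)).2 ⟨x, rfl⟩
      injective := hιinj
      exact_mid := fun y hy => (hιex y).1 hy
      surjective := S.T.redLE_surjective hit }
  obtain ⟨b, hb⟩ := hSES.exists_cohomologyMap_eq_of_cohomologyMap_eq_zero 1 c hc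
  exact ⟨b, hb⟩

/-- `H¹(red) ∘ H¹(ι) = 0` for such a presentation. [cite: Howard2004HeegnerKolyvagin, §1.6 (arXiv:1202.6340 p0011 L33–38)]
[cite: SerreGaloisCohomology1997, Ch. I §2.2] -/
theorem redLEH1_cohomologyMap_eq_zero (S : DVRSetting p K R N Rk Nbar Nq) {i t : ℕ}
    (hit : i ≤ t + 1) (ι : N 0 →ₗ[R] N (t + 1))
    (hιg : ∀ (g : absoluteGaloisGroup K) (x : N 0), ι (S.T.ρ 0 g x) = S.T.ρ (t + 1) g (ι x))
    (hιinj : Function.Injective ι) (hιex : ∀ y : N (t + 1), S.T.redLE hit y = 0 ↔ ∃ x, ι x = y)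
    (b : galoisCohomology (S.T.ρ 0) 1) :
    S.redLEH1 hit (ContinuousRep.cohomologyMap (S.T.ρ 0) (S.T.ρ (t + 1)) ι.toAddMonoidHom
      continuous_of_discreteTopology hιg 1 b) = 0 := by
  let f : (S.T.ρ 0).toTopRep ⟶ (S.T.ρ (t + 1)).toTopRep :=
    TopRep.ofHom ⟨⟨ι.toAddMonoidHom.toIntLinearMap, continuous_of_discreteTopology⟩,
      fun g => ContinuousLinearMap.ext fun x => hιg g x⟩
  let g : (S.T.ρ (t + 1)).toTopRep ⟶ (S.T.ρ i).toTopRep :=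
    TopRep.ofHom ⟨⟨(S.T.redLE hit).toAddMonoidHom.toIntLinearMap, continuous_of_discreteTopology⟩,
      fun g => ContinuousLinearMap.ext fun x => S.T.redLE_equivariant hit g x⟩
  have hSES : IsSES f g :=
    { comp_eq_zero := by
        ext x
        exact (hιex (ι x)).2 ⟨x, rfl⟩
      injective := hιinj
      exact_mid := fun y hy => (hιex y).1 hy
      surjective := S.T.redLE_surjective hit }
  exact hSES.cohomologyMap_comp_apply_eq_zero' 1 b

/-! ## §2 The snake bookkeeping: Selmer lifts versus global classes killing the local defects -/

/-- **Selmer lift ⟺ a global class kills the local defects (no duality).**  In the setting of the module docstring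
(`ι : N_0 → N_{t+1}` presenting `ker red_{t+1→i}`, its local `H¹`-maps cartesian for `𝓕(n)`; `ã` a global lift of `a` with
local defects `m_v`: `loc_v ã - ι_v m_v ∈ 𝓕(n)_{t+1,v}`): `a = H¹(red) z` for some `z ∈ H¹_{𝓕(n)}(K, N_{t+1})` iff there
is a GLOBAL `x ∈ H¹(K, N_0)` with `m_v - loc_v x ∈ 𝓕(n)_{0,v}` at every place `v` — then `z = ã - H¹(ι) x`.  (The two
ambiguities of the defects, `ι_v⁻¹(𝓕(n)_{t+1,v}) = 𝓕(n)_{0,v}` and the image of `H⁰(K_v, N_t)`, die in `𝓕(n)_{0,v}` by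
the cartesian property, H.3.)
[cite: Howard2004HeegnerKolyvagin, Prop. 1.4.1 (kernels) and H.3 (arXiv:1202.6340 p0008 L22–30, L94–98, p. 7 L60–70)]
[cite: Flach1990, proof of Thm. 1 (the kernel computation)] -/
theorem exists_selmer_redLEH1_eq_iff_exists_forall_sub_localization_mem (S : DVRSetting p K R N Rk Nbar Nq)
    {i t : ℕ} (hit : i ≤ t + 1) (n : Finset (HeightOneSpectrum (𝓞 K)))
    (ι : N 0 →ₗ[R] N (t + 1))
    (hιg : ∀ (g : absoluteGaloisGroup K) (x : N 0), ι (S.T.ρ 0 g x) = S.T.ρ (t + 1) g (ι x))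
    (hιinj : Function.Injective ι) (hιex : ∀ y : N (t + 1), S.T.redLE hit y = 0 ↔ ∃ x, ι x = y)
    (hιF : ∀ (v : Place K) (m : galoisCohomology ((S.T.ρ 0).toLocal v) 1),
      ContinuousRep.cohomologyMap ((S.T.ρ 0).toLocal v) ((S.T.ρ (t + 1)).toLocal v) ι.toAddMonoidHom
          continuous_of_discreteTopology (fun _ x => hιg _ x) 1 m ∈ ((S.t (t + 1)).atLevel S.jbar n).cond v ↔
        m ∈ ((S.t 0).atLevel S.jbar n).cond v)
    {a : galoisCohomology (S.T.ρ i) 1} (ã : galoisCohomology (S.T.ρ (t + 1)) 1) (hã : S.redLEH1 hit ã = a)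
    (m : ∀ v : Place K, galoisCohomology ((S.T.ρ 0).toLocal v) 1)
    (hm : ∀ v, ∃ ℓ ∈ ((S.t (t + 1)).atLevel S.jbar n).cond v,
      galoisCohomology.localization (S.T.ρ (t + 1)) v 1 ã - ℓ =
        ContinuousRep.cohomologyMap ((S.T.ρ 0).toLocal v) ((S.T.ρ (t + 1)).toLocal v) ι.toAddMonoidHom
          continuous_of_discreteTopology (fun _ x => hιg _ x) 1 (m v)) :
    (∃ z ∈ (((S.t (t + 1)).atLevel S.jbar n).cond).selmerGroup, S.redLEH1 hit z = a) ↔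
      ∃ x : galoisCohomology (S.T.ρ 0) 1, ∀ v : Place K,
        m v - galoisCohomology.localization (S.T.ρ 0) v 1 x ∈ ((S.t 0).atLevel S.jbar n).cond v := by
  -- notation: the global and local maps induced by `ι`, with their `galoisCohomology` types
  let ιH : galoisCohomology (S.T.ρ 0) 1 →+ galoisCohomology (S.T.ρ (t + 1)) 1 :=
    ContinuousRep.cohomologyMap (S.T.ρ 0) (S.T.ρ (t + 1)) ι.toAddMonoidHom continuous_of_discreteTopology hιg 1
  have hιH : ∀ b, ContinuousRep.cohomologyMap (S.T.ρ 0) (S.T.ρ (t + 1)) ι.toAddMonoidHom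
      continuous_of_discreteTopology hιg 1 b = ιH b := fun _ => rfl
  let ιL : ∀ v : Place K,
      galoisCohomology ((S.T.ρ 0).toLocal v) 1 →+ galoisCohomology ((S.T.ρ (t + 1)).toLocal v) 1 := fun v =>
    ContinuousRep.cohomologyMap ((S.T.ρ 0).toLocal v) ((S.T.ρ (t + 1)).toLocal v) ι.toAddMonoidHom
      continuous_of_discreteTopology (fun _ x => hιg _ x) 1
  have hιF' : ∀ (v : Place K) (y : galoisCohomology ((S.T.ρ 0).toLocal v) 1),
      ιL v y ∈ ((S.t (t + 1)).atLevel S.jbar n).cond v ↔ y ∈ ((S.t 0).atLevel S.jbar n).cond v := hιF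
  have hm' : ∀ v, ∃ ℓ ∈ ((S.t (t + 1)).atLevel S.jbar n).cond v,
      galoisCohomology.localization (S.T.ρ (t + 1)) v 1 ã - ℓ = ιL v (m v) := hm
  have hloc : ∀ (v : Place K) (x : galoisCohomology (S.T.ρ 0) 1),
      galoisCohomology.localization (S.T.ρ (t + 1)) v 1 (ιH x) =
        ιL v (galoisCohomology.localization (S.T.ρ 0) v 1 x) :=
    fun v x => localization_cohomologyMap_one (S.T.ρ 0) (S.T.ρ (t + 1)) ι.toAddMonoidHom hιg v x
  constructor
  · -- `⇒`: `ã - z ∈ ker H¹(red) = im H¹(ι)`, say `= H¹(ι) x`; then `ι_v(m_v - loc_v x) = (loc ã - ℓ) - loc ã + loc z`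
    rintro ⟨z, hz, hza⟩
    have h0 : S.redLEH1 hit (ã - z) = 0 := by rw [map_sub, hã, hza, sub_self]
    obtain ⟨x, hx⟩ := S.exists_cohomologyMap_eq_of_redLEH1_eq_zero hit ι hιg hιinj hιex (ã - z) h0
    rw [hιH] at hx
    refine ⟨x, fun v => ?_⟩
    obtain ⟨ℓ, hℓ, hℓeq⟩ := hm' v
    rw [← hιF' v, map_sub, ← hloc v x, hx, map_sub, ← hℓeq]
    have h1 : galoisCohomology.localization (S.T.ρ (t + 1)) v 1 z ∈ ((S.t (t + 1)).atLevel S.jbar n).cond v :=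
      (SelmerStructure.mem_selmerGroup_iff _ _).1 hz v
    have h2 := (((S.t (t + 1)).atLevel S.jbar n).cond v).sub_mem h1 hℓ
    -- `(loc ã - ℓ) - (loc ã - loc z) = loc z - ℓ`
    convert h2 using 1
    abel
  · -- `⇐`: `z := ã - H¹(ι) x` is an `𝓕(n)`-Selmer class reducing to `a`
    rintro ⟨x, hx⟩
    refine ⟨ã - ιH x, ?_, ?_⟩
    · rw [SelmerStructure.mem_selmerGroup_iff]
      intro v
      rw [map_sub, hloc v x]
      obtain ⟨ℓ, hℓ, hℓeq⟩ := hm' v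
      -- `loc ã - ι loc x = ℓ + ι (m_v - loc x)` since `loc ã - ℓ = ι m_v`
      have h1 := (hιF' v _).2 (hx v)
      rw [map_sub, ← hℓeq] at h1
      have h2 := (((S.t (t + 1)).atLevel S.jbar n).cond v).add_mem hℓ h1
      convert h2 using 1
      abel
    · rw [map_sub, hã, ← hιH, S.redLEH1_cohomologyMap_eq_zero hit ι hιg hιinj hιex x, sub_zero]

/-! ## §3 The criterion: local defects annihilated by `H¹_{𝓕(n)^*}(K, N_0^*)` under `∑_v inv_v(· ∪ ·)` -/

/-- **THE GLOBAL-DUALITY HALF OF PROP. 1.4.1's LEFT KERNEL (pairing-free).**  In the setting of the module docstring: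
`ι : N_0 → N_{t+1}` presenting `ker red_{t+1→i}` with cartesian `𝓕(n)`-conditions; `a = H¹(red) ã`; local defects `m_v`
(`loc_v ã - ι_v m_v ∈ 𝓕(n)_{t+1,v}`) supported on a finite set of places `Σ` containing the archimedean places and outside
which `𝓕(n)_0` is the unramified condition and `N_0` is unramified and prime to `n₀`; a family `inv` of local invariant maps
at a level `n₀` killing `N_0` with Poitou–Tate duality for Selmer structures (`SelmerComplement`, Howard Thm. 1.1.11) and
the reciprocity law (`SumLocalTermEqZero`).  THEN `a ∈ H¹(red)(H¹_{𝓕(n)}(K, N_{t+1}))` IFF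
`∑_{v ∈ Σ} inv_v(m_v ∪ loc_v y) = 0` for every `y ∈ H¹_{𝓕(n)_0^*}(K, N_0^*)` — Flach's «the local defects of a class pairing
to zero are killed by a global class» (Thm. 1.1.11 for `𝓕(n)_0 ≤ 𝓖 =` everything on `Σ`) composed with §2; conversely the
local terms of `(m_v - loc_v x, y_v) ∈ 𝓕 × 𝓕^*` vanish and `∑_v ⟨loc_v x, loc_v y⟩_v = 0`.
[cite: Howard2004HeegnerKolyvagin, Prop. 1.4.1 (kernels: «a straightforward modification of the methods of [Flach]») and Thm. 1.1.11 (arXiv:1202.6340 p0008 L83–98, p. 6)]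
[cite: Flach1990, proof of Thm. 1 (the kernel computation)] [cite: MilneADT2006, Ch. I, Thm. 4.10] -/
theorem exists_selmer_redLEH1_eq_iff_forall_sum_localTatePairingZMod_eq_zero (S : DVRSetting p K R N Rk Nbar Nq)
    [Finite (N 0)] {i t : ℕ} (hit : i ≤ t + 1) (n : Finset (HeightOneSpectrum (𝓞 K)))
    (ι : N 0 →ₗ[R] N (t + 1))
    (hιg : ∀ (g : absoluteGaloisGroup K) (x : N 0), ι (S.T.ρ 0 g x) = S.T.ρ (t + 1) g (ι x))
    (hιinj : Function.Injective ι) (hιex : ∀ y : N (t + 1), S.T.redLE hit y = 0 ↔ ∃ x, ι x = y)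
    (hιF : ∀ (v : Place K) (m : galoisCohomology ((S.T.ρ 0).toLocal v) 1),
      ContinuousRep.cohomologyMap ((S.T.ρ 0).toLocal v) ((S.T.ρ (t + 1)).toLocal v) ι.toAddMonoidHom
          continuous_of_discreteTopology (fun _ x => hιg _ x) 1 m ∈ ((S.t (t + 1)).atLevel S.jbar n).cond v ↔
        m ∈ ((S.t 0).atLevel S.jbar n).cond v)
    -- Poitou–Tate data at the level `N_0`
    {n₀ : ℕ} [NeZero n₀] (hM : ∀ x : N 0, n₀ • x = 0) (inv : LocalInvariants K n₀)
    (hSC : inv.SelmerComplement) (hPT : inv.SumLocalTermEqZero)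
    (Sfin : Finset (Place K))
    (hSp : ∀ v : HeightOneSpectrum (𝓞 K), (Sum.inr v : Place K) ∉ Sfin →
      ((n₀ : ℕ) : 𝓞 K) ∉ v.asIdeal ∧ GaloisRep.IsUnramifiedAt v (S.T.ρ 0))
    (hFS : (((S.t 0).atLevel S.jbar n).cond).IsUnramifiedOutside Sfin)
    -- the class, a global lift and its local defects, supported on `Sfin`
    {a : galoisCohomology (S.T.ρ i) 1} (ã : galoisCohomology (S.T.ρ (t + 1)) 1) (hã : S.redLEH1 hit ã = a)
    (m : ∀ v : Place K, galoisCohomology ((S.T.ρ 0).toLocal v) 1)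
    (hm : ∀ v, ∃ ℓ ∈ ((S.t (t + 1)).atLevel S.jbar n).cond v,
      galoisCohomology.localization (S.T.ρ (t + 1)) v 1 ã - ℓ =
        ContinuousRep.cohomologyMap ((S.T.ρ 0).toLocal v) ((S.T.ρ (t + 1)).toLocal v) ι.toAddMonoidHom
          continuous_of_discreteTopology (fun _ x => hιg _ x) 1 (m v))
    (hmS : ∀ v ∉ Sfin, m v = 0) :
    (∃ z ∈ (((S.t (t + 1)).atLevel S.jbar n).cond).selmerGroup, S.redLEH1 hit z = a) ↔
      ∀ y ∈ (inv.dualSelmerStructure (S.T.ρ 0) ((S.t 0).atLevel S.jbar n).cond).selmerGroup,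
        ∑ v ∈ Sfin, localTatePairingZMod (S.T.ρ 0) n₀ v (inv v) (m v)
          (galoisCohomology.localization ((S.T.ρ 0).tateDual n₀) v 1 y) = 0 := by
  classical
  rw [S.exists_selmer_redLEH1_eq_iff_exists_forall_sub_localization_mem hit n ι hιg hιinj hιex hιF ã hã m hm]
  set 𝓕₀ : SelmerStructure (S.T.ρ 0) := ((S.t 0).atLevel S.jbar n).cond with h𝓕₀
  constructor
  · -- `⇒`: local terms of `(m_v - x_v, y_v) ∈ 𝓕 × 𝓕^*` vanish, and `∑_v ⟨x_v, y_v⟩_v = 0` (reciprocity)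
    rintro ⟨x, hx⟩ y hy'
    have hxy : ∀ v, localTatePairingZMod (S.T.ρ 0) n₀ v (inv v) (m v)
        (galoisCohomology.localization ((S.T.ρ 0).tateDual n₀) v 1 y) = inv.localTerm (S.T.ρ 0) v x y := by
      intro v
      have hyv := (SelmerStructure.mem_selmerGroup_iff _ _).1 hy' v
      rw [LocalInvariants.dualSelmerStructure_apply, LocalInvariants.mem_dualLocalCondition_iff] at hyv
      have h1 := hyv _ (hx v)
      rw [map_sub, AddMonoidHom.sub_apply, sub_eq_zero] at h1
      rw [h1, LocalInvariants.localTerm_apply, localTatePairingZMod_apply]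
    simp_rw [hxy]
    -- the local terms of the global pair `(x, y)` vanish off `Sfin` (`x_v ∈ 𝓕₀ v ∋⊥ y_v`), so reciprocity applies
    refine hPT (S.T.ρ 0) hM x y Sfin fun v hv => ?_
    have hxv : galoisCohomology.localization (S.T.ρ 0) v 1 x ∈ 𝓕₀ v := by
      have h1 := hx v
      rw [hmS v hv, zero_sub] at h1
      exact neg_mem_iff.1 h1
    exact inv.localTerm_eq_zero_of_mem_of_mem_dual (S.T.ρ 0) v (𝓕₀ v) hxv
      ((SelmerStructure.mem_selmerGroup_iff _ _).1 hy' v)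
  · -- `⇐`: Poitou–Tate for `𝓕₀ ≤ 𝓖 :=` everything on `Sfin`, `𝓕₀` off `Sfin`
    intro hsum
    let 𝓖 : SelmerStructure (S.T.ρ 0) := fun v => if v ∈ Sfin then ⊤ else 𝓕₀ v
    have h𝓖_of_mem : ∀ v ∈ Sfin, 𝓖 v = ⊤ := fun v hv => if_pos hv
    have h𝓖_of_not_mem : ∀ v ∉ Sfin, 𝓖 v = 𝓕₀ v := fun v hv => if_neg hv
    have hle : 𝓕₀ ≤ 𝓖 := by
      intro v
      by_cases hv : v ∈ Sfin
      · rw [h𝓖_of_mem v hv]; exact le_top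
      · rw [h𝓖_of_not_mem v hv]
    have h𝓖S : 𝓖.IsUnramifiedOutside Sfin := by
      refine ⟨hFS.1, fun v hv => ?_⟩
      rw [h𝓖_of_not_mem _ hv]
      exact hFS.2 v hv
    obtain ⟨x, hx𝓖, hx⟩ := (hSC (S.T.ρ 0) hM Sfin hSp 𝓕₀ 𝓖 hle hFS h𝓖S).1 m
      (fun v hv => by rw [h𝓖_of_mem v hv]; exact AddSubgroup.mem_top _) hsum
    refine ⟨x, fun v => ?_⟩
    by_cases hv : v ∈ Sfin
    · have h1 := (𝓕₀ v).neg_mem (hx v hv)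
      rwa [neg_sub] at h1
    · rw [hmS v hv, zero_sub, neg_mem_iff]
      have h1 := (SelmerStructure.mem_selmerGroup_iff _ _).1 hx𝓖 v
      rwa [h𝓖_of_not_mem v hv] at h1

/-! ## §4 Local defects from local Selmer lifts (the local exact sequences (1)(2) of p0008 L22–30, consumed) -/

/-- **Local defects from local Selmer lifts.**  For the presentation `ι` of `ker red_{t+1→i}` as above, a global
`ã ∈ H¹(K, N_{t+1})` and a finite set of places `Σ`: if at every `v ∈ Σ` the class `loc_v (H¹(red) ã)` has a local
`𝓕(n)`-Selmer lift `ℓ_v ∈ 𝓕(n)_{t+1,v}` (`H¹_v(red) ℓ_v = H¹_v(red) (loc_v ã)` — Howard's surjection (2) /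
Morgan–Smith's `π(𝒲) = 𝒲₂`), and off `Σ` already `loc_v ã ∈ 𝓕(n)_{t+1,v}`, then there are LOCAL DEFECTS `m_v ∈ H¹(K_v, N_0)`,
`loc_v ã - ℓ_v = ι_v m_v`, supported on `Σ` (exactness of `H¹(K_v, N_0) →ι H¹(K_v, N_{t+1}) →red H¹(K_v, N_i)` in the middle,
place by place) — the data of §2–§3.
[cite: Howard2004HeegnerKolyvagin, §1.4, the exact sequences (1)(2) and the local lifts β'_v (arXiv:1202.6340 p0008 L22–30, L60–70)]
[cite: SerreGaloisCohomology1997, Ch. I §2.2] -/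
theorem exists_localDefects_of_forall_exists_redLELoc_eq (S : DVRSetting p K R N Rk Nbar Nq) {i t : ℕ}
    (hit : i ≤ t + 1) (n : Finset (HeightOneSpectrum (𝓞 K))) (ι : N 0 →ₗ[R] N (t + 1))
    (hιg : ∀ (g : absoluteGaloisGroup K) (x : N 0), ι (S.T.ρ 0 g x) = S.T.ρ (t + 1) g (ι x))
    (hιinj : Function.Injective ι) (hιex : ∀ y : N (t + 1), S.T.redLE hit y = 0 ↔ ∃ x, ι x = y)
    (ã : galoisCohomology (S.T.ρ (t + 1)) 1) (Sfin : Finset (Place K))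
    (hℓ : ∀ v ∈ Sfin, ∃ ℓ ∈ ((S.t (t + 1)).atLevel S.jbar n).cond v,
      S.redLELoc hit v ℓ = S.redLELoc hit v (galoisCohomology.localization (S.T.ρ (t + 1)) v 1 ã))
    (hout : ∀ v ∉ Sfin, galoisCohomology.localization (S.T.ρ (t + 1)) v 1 ã ∈ ((S.t (t + 1)).atLevel S.jbar n).cond v) :
    ∃ m : ∀ v : Place K, galoisCohomology ((S.T.ρ 0).toLocal v) 1,
      (∀ v, ∃ ℓ ∈ ((S.t (t + 1)).atLevel S.jbar n).cond v,
        galoisCohomology.localization (S.T.ρ (t + 1)) v 1 ã - ℓ =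
          ContinuousRep.cohomologyMap ((S.T.ρ 0).toLocal v) ((S.T.ρ (t + 1)).toLocal v) ι.toAddMonoidHom
            continuous_of_discreteTopology (fun _ x => hιg _ x) 1 (m v)) ∧
      ∀ v ∉ Sfin, m v = 0 := by
  classical
  -- local middle exactness at every place
  have hexact : ∀ (v : Place K) (c : galoisCohomology ((S.T.ρ (t + 1)).toLocal v) 1), S.redLELoc hit v c = 0 →
      ∃ b : galoisCohomology ((S.T.ρ 0).toLocal v) 1,
        ContinuousRep.cohomologyMap ((S.T.ρ 0).toLocal v) ((S.T.ρ (t + 1)).toLocal v) ι.toAddMonoidHom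
          continuous_of_discreteTopology (fun _ x => hιg _ x) 1 b = c := by
    intro v c hc
    haveI : CompactSpace (absoluteGaloisGroup (Place.Completion v)) := absoluteGaloisGroup_compactSpace _
    let f : ((S.T.ρ 0).toLocal v).toTopRep ⟶ ((S.T.ρ (t + 1)).toLocal v).toTopRep :=
      TopRep.ofHom ⟨⟨ι.toAddMonoidHom.toIntLinearMap, continuous_of_discreteTopology⟩,
        fun g => ContinuousLinearMap.ext fun x => hιg _ x⟩
    let g : ((S.T.ρ (t + 1)).toLocal v).toTopRep ⟶ ((S.T.ρ i).toLocal v).toTopRep :=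
      TopRep.ofHom ⟨⟨(S.T.redLE hit).toAddMonoidHom.toIntLinearMap, continuous_of_discreteTopology⟩,
        fun g => ContinuousLinearMap.ext fun x => S.T.redLE_equivariant hit _ x⟩
    have hSES : IsSES f g :=
      { comp_eq_zero := by
          ext x
          exact (hιex (ι x)).2 ⟨x, rfl⟩
        injective := hιinj
        exact_mid := fun y hy => (hιex y).1 hy
        surjective := S.T.redLE_surjective hit }
    obtain ⟨b, hb⟩ := hSES.exists_cohomologyMap_eq_of_cohomologyMap_eq_zero 1 c hc
    exact ⟨b, hb⟩
  -- at `v ∈ Sfin`: `loc ã - ℓ_v` dies under `red`, so it is `ι_v m_v`; elsewhere `m_v = 0`, `ℓ_v = loc ã`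
  have hchoice : ∀ v : Place K, ∃ (m : galoisCohomology ((S.T.ρ 0).toLocal v) 1),
      (∃ ℓ ∈ ((S.t (t + 1)).atLevel S.jbar n).cond v,
        galoisCohomology.localization (S.T.ρ (t + 1)) v 1 ã - ℓ =
          ContinuousRep.cohomologyMap ((S.T.ρ 0).toLocal v) ((S.T.ρ (t + 1)).toLocal v) ι.toAddMonoidHom
            continuous_of_discreteTopology (fun _ x => hιg _ x) 1 m) ∧ (v ∉ Sfin → m = 0) := by
    intro v
    by_cases hv : v ∈ Sfin
    · obtain ⟨ℓ, hℓ, hℓred⟩ := hℓ v hv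
      obtain ⟨b, hb⟩ := hexact v (galoisCohomology.localization (S.T.ρ (t + 1)) v 1 ã - ℓ)
        (by rw [map_sub, hℓred, sub_self])
      exact ⟨b, ⟨ℓ, hℓ, hb.symm⟩, fun h => absurd hv h⟩
    · exact ⟨0, ⟨_, hout v hv, by rw [sub_self]; exact (map_zero _).symm⟩, fun _ => rfl⟩
  choose m hm hm0 using hchoice
  exact ⟨m, hm, hm0⟩

end DVRSetting

end Literature.NumberTheory.GaloisCohomology.Howard2004

end
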